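/-
Copyright: derived here (Resolution Observatory cell `pub-rosobs`, carver gen 58). AI-written Lean; AI review is weaker than expert
review.  INVARIANT DIRECTIONS of a form and the perfect-field step of engine 1's COROLLARY B‴(b) / THEOREM B⁗(i) (THEOREM-LT-eng1-g38
§11–§12) in the cell's polynomial weighted-centre model `W(f)`.  Instrument — NOT a resolution theorem and NOT a statement about the
invariant of [AbramovichTemkinWlodarczyk2024].
-/
import Literature.AlgebraicGeometry.Resolution.WeightedCentreHeavyTaylor
import Mathlib.RingTheory.MvPolynomial.Homogeneous
import Mathlib.RingTheory.MvPolynomial.WeightedHomogeneous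
import Mathlib.Algebra.MvPolynomial.PDeriv
import Mathlib.Algebra.Polynomial.BigOperators
import Mathlib.Algebra.Polynomial.Degree.Lemmas
import Mathlib.Algebra.Polynomial.AlgebraMap
import Mathlib.Algebra.MvPolynomial.Variables
import Mathlib.Algebra.MvPolynomial.Monad
import Mathlib.Algebra.CharP.Lemmas
import Mathlib.FieldTheory.Finite.Basic
import Mathlib.RingTheory.MvPolynomial.Basic
import Mathlib.Data.Finset.Card
import Mathlib.LinearAlgebra.Matrix.Transvection
import Mathlib.LinearAlgebra.Matrix.NonsingularInverse
import Mathlib.Tactic.Ring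
import Mathlib.Tactic.LinearCombination
import HarnessLib

/-!
# Invariant directions and the perfect-field rank-one step (COROLLARY B‴(b), THEOREM B⁗(i))

Uniform value line: INSTRUMENT — elementary algebra for engine 1's classification of the sharp face in the cell's polynomial
weighted-centre model `W(f)`; NOT a resolution theorem, NOT a statement about the Abramovich–Temkin–Włodarczyk invariant, NOT summit
progress; AI-written Lean, AI review is weaker than expert review.

## Dictionary (THEOREM-LT §11 COROLLARY B‴ proof, §12 THEOREM B⁗ (i) ↔ this file)

* "`F` has NO invariant direction `v ≠ 0` (`F(f + tv) ≡ F(f)`)": `IsInvariantDir F v := lineShift v F = C F`, where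
  `lineShift v F = F(X + t·v) ∈ K[X][t]` (`lineShift`; definitionally the one-parameter Taylor polynomial of
  `WeightedCentreTaylorLayers` at the generic point with a constant direction).
* "a coordinate that occurs in no monomial is an invariant direction": `isInvariantDir_single_of_notMem_vars`; more generally
  `lineShift_eq_C_of_vars` (`F(X + tv) = F(X)` when `v` vanishes on the variables of `F`).
* "`k` perfect: `Σ_{i≤r} a_i f_i^p = (Σ a_i^{1/p} f_i)^p =: 𝓊^p`": `sum_C_mul_X_pow_char` (with chosen `p`-th roots `b_i`, `b_i^p = a_i` —
  over a perfect field they exist; we take them as data).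
* "if `r ≥ 2` pick `v ≠ 0` in `span(e_1,…,e_r)` with `𝓊(v) = 0`": `exists_kernelVector_of_one_lt_card`.
* "`P(f + tv, V) ≡ P(f, V)`" for `P = Σ_{i≤r} a_i f_i^p + P₀(f″, V)`: `isInvariantDir_frobeniusForm` and the packaged
  `exists_isInvariantDir_of_two_le_card` (= the step "`r ≥ 2` ⇒ an invariant direction inside the moved slots exists", which with the
  cell's pin condition `(P)` gives `r = 1`: RANK ONE; and with `S` = both slots, `P₀ = 0`: "m = 2 is impossible" of COROLLARY B‴(b)).
* NOT here: the unfolding "invariant direction ⇒ in an adapted basis the coordinate does not occur ⇒ ¬(P)" (a linear change of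
  coordinates; cf. `WeightedCentreLinearRigidity`, `WeightedCentreFrobeniusPin.eq_single_of_lineSubst`), B⁗ (ii)–(iv).

Coordinate criterion (REMARK D of THEOREM-LT §12, case `A = id`): `lineShift_smul` / `IsInvariantDir.smul` (scaling),
`notMem_vars_of_isInvariantDir_single_one` (if `e_i` is invariant then `X_i` does not occur — kill `X_i` coefficientwise and re-
substitute `t := X_i`; valid over any commutative ring, in particular in characteristic `p` where `∂_i F = 0` alone would not suffice),
`isInvariantDir_single_iff` (over a field, `c ≠ 0`: `c e_i` invariant iff `i ∉ vars F`).

REMARK D, `f`-side (THEOREM-LT §12): `linSubst A` (`X_j ↦ Σ_k A_{jk} X_k`, `F ↦ F∘A`), `lineShift_single_linSubst` (the conjugation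
identity `(F∘A)(X + t e_i) = F(AX + t·Ae_i)`), `isInvariantDir_linSubst_single_iff` (injective `A`: `e_i` invariant for `F∘A` iff the
column `Ae_i` is invariant for `F`), `mem_vars_linSubst_iff` (over a field: `X_i` occurs in `F∘A` iff `Ae_i` is NOT an invariant
direction of `F`).  COROLLARY B⁗′(b), invariant-direction half, for `F = a X_i^p + F₀(X″)`: `isInvariantDir_of_additive` (if `F₀` is
additive along `v″` and `a r^p + F₀(v″) = 0` then `v″ + r e_i` is invariant — the engine's `v := ((−F₀(v″)/a)^{1/p}, v″)`),
`eq_zero_of_isInvariantDir_single` (`a` a non-zero-divisor: no non-zero multiple of `e_i` is invariant — "an invariant `v` has `v″ ≠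
0`").  The remaining direction of the equivalence "`F` has an invariant direction iff `F₀` is additive along some `v″ ≠ 0`" is the
converse half below (it needs the top Taylor coefficient `F₀(v″)`, the `lineShift` analogue of `WeightedCentreTaylorLayers.coeff_taylorLine_of_isHomogeneous`).

COROLLARY B⁗′(b), converse half: `coeff_lineShift_of_isHomogeneous` (the top Taylor coefficient of a degree-`n` form along `v` is `F(v)`; with
`lineShift_monomial`, `natDegree_lineShift_monomial_le`, `natDegree_lineShift_le`) and `additive_of_isInvariantDir` (`v` invariant for `a X_i^p + F₀`, `F₀` a
degree-`p` form free of `X_i` ⇒ `a v_i^p + F₀(v″) = 0` and `F₀(X + t v″) = F₀(X) + t^p F₀(v″)`), closing the equivalence announced above.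

v5 (carver-g59, section `Quadratic`; the decls above it are unchanged) — PROPOSITION H's radical criterion (THEOREM-LT §13: "`q₂` has no invariant
direction ⇔ `q₂(V + tv) − q₂(V) = 2tB(V, v) + t²q₂(v)`, `rad B = 0`: `q₂` nondegenerate"): `lineShift_quadraticForm` (that expansion for
`q = Σ_{i,j∈S} b_{ij} X_i X_j`), `polar_eq_linearForm` (`b` symmetric: the `t`-coefficient is `Σ_i (2Σ_j b_{ij}v_j) X_i`),
`isInvariantDir_quadraticForm_of_radical` / `radical_of_isInvariantDir_quadraticForm` / `isInvariantDir_quadraticForm_iff` (domain, `2 ≠ 0`: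
`v` invariant ⇔ `Σ_j b_{ij} v_j = 0` on `S`), `eq_zero_of_radical_of_leftInverse` (a left inverse of `b|_{S×S}` — the nondegeneracy hypothesis of
`WeightedCentreQuadraticSpectator.delta_eq_zero_of_fix` — kills the radical on `S`), `mem_vars_linSubst_quadraticForm_iff` (field: `X_i` occurs in
`q∘A` iff the column `Ae_i` is not `b`-orthogonal to `S`).  NOT here: "(P) for the class `V` ⇔ …" itself (pins are a modelling notion of the cell).

v6 (carver-g59, section `GLMove`; the decls above it are unchanged) — the GL-move behind every "(P) ⇒ no invariant direction" step (THEOREM-LT §15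
PROP F: "in coordinates with `v₀ = e₁` … `f₁` is unpinned — contradicting (P)"; §12 B⁗ (i); §13 PROP H's "every nonzero `v` is `Ae_i`"): `linSubst_one`,
`linSubst_linSubst` (`(F∘B)∘A = F∘(BA)`), `linSubst_injective_of_mul_eq_one`, `det_updateCol_one`, `exists_mul_eq_one_col_eq` (field: every `v ≠ 0` is the
`i`-th column of an invertible matrix — identity with column `i` replaced, times a transvection), and the GLOBAL form of REMARK D:
`not_isInvariantDir_of_forall_mem_vars` ("`X_i` occurs in `F∘A` for every invertible `A`" ⇒ `F` has no nonzero invariant direction) and its converse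
`mem_vars_linSubst_of_forall_not_isInvariantDir`, packaged as `forall_mem_vars_linSubst_iff` — "(P) for the class ⇔ no invariant direction" as an iff over a field.
v7 (carver-g59; one corollary appended to section `GLMove`, nothing else changed): `card_le_one_of_forall_mem_vars` — THEOREM B⁗ (i) RANK ONE (`r = 1`) under the
formal (P), joining `exists_isInvariantDir_of_two_le_card` (v3) with `not_isInvariantDir_of_forall_mem_vars` (v6).
v8 (carver-g60, section `FrobeniusSplitting`; the decls above it are unchanged) — THEOREM B⁗ (i)–(ii) with the Frobenius normal form DERIVED:
`eq_single_of_pderiv_eq_zero` / **`eq_sum_frobenius_add`** (characteristic `p`, positive rational weights, `P` weighted homogeneous of weight `μ = p·w_i`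
and `∂_i P = 0` on `S` ⇒ the only monomial of `P` containing `X_i` is `X_i^p`, so `P = Σ_{i∈S} (coeff_{pe_i}P) X_i^p + P₀`, `P₀` free of the
`S`-variables — §12 (i) "`P ∈ k[f_i^p, f″, V]` and since `f_i^p` already has value 1 …", and (ii) "`∂_{f₁}g = 0 ⇒ g = af₁^p + g₀`" as `S = {f₁}`);
`eq_zero_of_sum_linearForm_mul` (§12 (i) first step: `Σ_a ℓ_a(W)·Q_a = 0` with the `ℓ_a` independent — a right inverse of the coefficient matrix as
data — and the `Q_a` `W`-free ⇒ `Q_a = 0`; differentiate along `W_n` and invert); packaged `card_le_one_of_pderiv_eq_zero` and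
**`card_le_one_of_D_eq_zero`** (`D = Σ_a ℓ_a(W)∂_{f_a}`, `DP = 0`, `P` `W`-free, formal (P), `p`-th roots of the diagonal coefficients as data ⇒
`r ≤ 1`: RANK ONE end to end for the pin part `P`).  Bookkeeping re-derived here: `dvd_of_pderiv_eq_zero`, `notMem_vars_pderiv`
(v8 also carried copies `natCast_mul_le_weight`, `eq_zero_of_weight_eq_zero` of the `G28Face` lemmas; v9 inlines them — one named copy in the tree).  NOT here: the extraction of the pin part `P` from `g` and of `DP = 0` from `Dg = 0`
(the `W`-degree-1, `I`-free component — cell modelling of (P)), perfectness (roots are data).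
v9 (carver-g60; two decls appended to section `FrobeniusSplitting`, nothing else changed): `card_le_one_of_D_eq_zero_of_surjective_frobenius`
(if every element of `L` is a `p`-th power the root data are automatic: `DP = 0` + (P) ⇒ `r ≤ 1` outright) and `exists_pow_eq_zmod` (that hypothesis
for `𝔽_p`, `ZMod.pow_card`).

References: engine 1, THEOREM-LT-eng1-g38 §11 (COROLLARY B‴) and §12 (THEOREM B⁗ (i)); Frobenius additivity [Lang2002, Ch. V §6];
context [AbramovichTemkinWlodarczyk2024] §5.  Statements and formalisation ours, elementary.
-/

namespace Literature.AlgebraicGeometry.Resolution.WeightedBlowup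

namespace InvariantDirection

open MvPolynomial

variable {K : Type*} [CommRing K] {ι : Type*}

/-- `F ↦ F(X + t·v) ∈ K[X][t]`: the shift of the generic point along the constant direction `v` (ours). [cite: Lang2002, Ch. IV §1] -/
noncomputable def lineShift (v : ι → K) : MvPolynomial ι K →ₐ[K] Polynomial (MvPolynomial ι K) :=
  MvPolynomial.aeval fun i => Polynomial.C (X i) + Polynomial.X * Polynomial.C (C (v i))

/-- `lineShift` on a variable (ours, bookkeeping). [cite: Lang2002, Ch. IV §1] -/
@[simp] theorem lineShift_X (v : ι → K) (i : ι) :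
    lineShift v (X i : MvPolynomial ι K) = Polynomial.C (X i) + Polynomial.X * Polynomial.C (C (v i)) := by
  simp [lineShift]

/-- `lineShift` on a constant (ours, bookkeeping). [cite: Lang2002, Ch. IV §1] -/
@[simp] theorem lineShift_C (v : ι → K) (a : K) :
    lineShift v (C a : MvPolynomial ι K) = Polynomial.C (C a) := by
  simp [lineShift, Polynomial.algebraMap_apply, MvPolynomial.algebraMap_eq]

/-- `v` is an INVARIANT DIRECTION of `F`: `F(X + t v) = F(X)` identically in `t` (ours; the engine's "`F(f + tv) ≡ F(f)`").
[cite: Lang2002, Ch. IV §1] -/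
def IsInvariantDir (F : MvPolynomial ι K) (v : ι → K) : Prop := lineShift v F = Polynomial.C F

/-- If `v` vanishes on every variable occurring in `F`, then `F(X + t v) = F(X)` (ours). [cite: Lang2002, Ch. IV §1] -/
theorem lineShift_eq_C_of_vars (v : ι → K) (F : MvPolynomial ι K) (h : ∀ i ∈ F.vars, v i = 0) :
    lineShift v F = Polynomial.C F := by
  classical
  change (lineShift v : MvPolynomial ι K →+* _) F = (Polynomial.C : MvPolynomial ι K →+* _) F
  refine MvPolynomial.hom_congr_vars ?_ (fun i hi _ => ?_) rfl
  · ext a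
    simp
  · rw [RingHom.coe_coe, lineShift_X, h i hi]
    simp

/-- Two directions agreeing on the variables of `F` give the same shift (ours, bookkeeping). [cite: Lang2002, Ch. IV §1] -/
theorem lineShift_congr_vars (v v' : ι → K) (F : MvPolynomial ι K) (h : ∀ i ∈ F.vars, v i = v' i) :
    lineShift v F = lineShift v' F := by
  classical
  change (lineShift v : MvPolynomial ι K →+* Polynomial (MvPolynomial ι K)) F =
    (lineShift v' : MvPolynomial ι K →+* Polynomial (MvPolynomial ι K)) F
  refine MvPolynomial.hom_congr_vars ?_ (fun i hi _ => ?_) rfl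
  · ext a
    simp
  · rw [RingHom.coe_coe, RingHom.coe_coe, lineShift_X, lineShift_X, h i hi]

/-- A coordinate direction of a variable not occurring in `F` is invariant (ours; "the `v`-coordinate occurs in no monomial").
[cite: Lang2002, Ch. IV §1] -/
theorem isInvariantDir_single_of_notMem_vars [DecidableEq ι] (F : MvPolynomial ι K) {i : ι} (hi : i ∉ F.vars) (c : K) :
    IsInvariantDir F (Pi.single i c) :=
  lineShift_eq_C_of_vars _ F fun j hj => by
    rw [Pi.single_apply, if_neg]
    rintro rfl
    exact hi hj

/-- `lineShift` of a linear form `Σ_{i∈S} b_i X_i` is `C(Σ b_i X_i) + t · Σ_{i∈S} b_i v_i` (ours). [cite: Lang2002, Ch. IV §1] -/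
theorem lineShift_linearForm (v : ι → K) (S : Finset ι) (b : ι → K) :
    lineShift v (∑ i ∈ S, C (b i) * X i) =
      Polynomial.C (∑ i ∈ S, C (b i) * X i) + Polynomial.X * Polynomial.C (C (∑ i ∈ S, b i * v i)) := by
  simp only [map_sum, map_mul, lineShift_C, lineShift_X, Finset.mul_sum, ← Finset.sum_add_distrib]
  refine Finset.sum_congr rfl fun i _ => ?_
  ring

/-- Frobenius collapse of a diagonal `p`-form with `p`-th roots: `Σ_{i∈S} b_i^p X_i^p = (Σ_{i∈S} b_i X_i)^p` in characteristic `p`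
(ours; the engine's "`k` perfect: `Σ a_i f_i^p = 𝓊^p`" with `b_i := a_i^{1/p}`). [cite: Lang2002, Ch. V §6] -/
theorem sum_C_mul_X_pow_char (p : ℕ) [Fact p.Prime] [CharP K p] (S : Finset ι) (b : ι → K) :
    (∑ i ∈ S, C (b i ^ p) * X i ^ p : MvPolynomial ι K) = (∑ i ∈ S, C (b i) * X i) ^ p := by
  rw [sum_pow_char]
  refine Finset.sum_congr rfl fun i _ => ?_
  rw [mul_pow, map_pow]

/-- **Invariance of the Frobenius form along its kernel** (ours; the engine's "`P(f + tv, V) ≡ P(f, V)`"): if `Σ_{i∈S} b_i v_i = 0`, `v`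
vanishes off `S` and `P₀` involves no variable of `S`, then `v` is an invariant direction of `(Σ_{i∈S} b_i X_i)^p + P₀`.
[cite: Lang2002, Ch. IV §1] -/
theorem isInvariantDir_frobeniusForm (p : ℕ) (S : Finset ι) (b v : ι → K) (hv : ∑ i ∈ S, b i * v i = 0)
    (hvS : ∀ i, i ∉ S → v i = 0) (P₀ : MvPolynomial ι K) (hP₀ : ∀ i ∈ S, i ∉ P₀.vars) :
    IsInvariantDir ((∑ i ∈ S, C (b i) * X i) ^ p + P₀) v := by
  unfold IsInvariantDir
  rw [map_add, map_pow, lineShift_linearForm, hv, lineShift_eq_C_of_vars v P₀ fun i hi => hvS i fun hiS => hP₀ i hiS hi]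
  simp

/-- In at least two coordinates a linear functional has a non-zero kernel vector supported there (ours; the engine's "if `r ≥ 2` pick
`v ≠ 0` in `span(e_1,…,e_r)` with `𝓊(v) = 0`"). [cite: Lang2002, Ch. III §5] -/
theorem exists_kernelVector_of_one_lt_card [DecidableEq ι] [IsDomain K] (S : Finset ι) (hS : 1 < S.card) (b : ι → K) :
    ∃ v : ι → K, v ≠ 0 ∧ (∀ i, i ∉ S → v i = 0) ∧ ∑ i ∈ S, b i * v i = 0 := by
  obtain ⟨i, hi, j, hj, hij⟩ := Finset.one_lt_card.mp hS
  by_cases hb : b i = 0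
  · refine ⟨Pi.single i 1, ?_, ?_, ?_⟩
    · intro h
      have := congrFun h i
      simp at this
    · intro l hl
      rw [Pi.single_apply, if_neg]
      rintro rfl
      exact hl hi
    · rw [Finset.sum_eq_single_of_mem i hi]
      · simp [hb]
      · intro l _ hli
        simp [hli]
  · refine ⟨(Pi.single i (b j) - Pi.single j (b i) : ι → K), ?_, ?_, ?_⟩
    · intro h
      have := congrFun h j
      simp [hij.symm, hb] at this
    · intro l hl
      have hli : l ≠ i := by rintro rfl; exact hl hi
      have hlj : l ≠ j := by rintro rfl; exact hl hj
      simp [hli, hlj]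
    · have hsplit : ∀ l ∈ S, b l * (Pi.single i (b j) - Pi.single j (b i) : ι → K) l =
          (if l = i then b i * b j else 0) - (if l = j then b j * b i else 0) := by
        intro l _
        simp only [Pi.sub_apply, Pi.single_apply, mul_sub]
        congr 1
        · split_ifs with h
          · subst h; rfl
          · rw [mul_zero]
        · split_ifs with h
          · subst h; rfl
          · rw [mul_zero]
      rw [Finset.sum_congr rfl hsplit, Finset.sum_sub_distrib, Finset.sum_ite_eq' S i, Finset.sum_ite_eq' S j, if_pos hi,
        if_pos hj, mul_comm, sub_self]

/-- **The perfect-field rank-one step** (COROLLARY B‴(b) "`r = 1`" and "`m = 2` impossible"; THEOREM B⁗ (i) RANK ONE — ours as a formal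
statement): in characteristic `p`, if the diagonal coefficients `a_i` (`i ∈ S`, `|S| ≥ 2`) have `p`-th roots `b_i` and `P₀` involves no
variable of `S`, then `Σ_{i∈S} a_i X_i^p + P₀` has a non-zero invariant direction supported in `S` — so under the cell's pin condition
`(P)` at most ONE slot of the class can be moved.  Over a field. [cite: Lang2002, Ch. V §6] -/
theorem exists_isInvariantDir_of_two_le_card [DecidableEq ι] [IsDomain K] (p : ℕ) [Fact p.Prime] [CharP K p] (S : Finset ι)
    (hS : 1 < S.card) (a b : ι → K) (hb : ∀ i ∈ S, b i ^ p = a i) (P₀ : MvPolynomial ι K) (hP₀ : ∀ i ∈ S, i ∉ P₀.vars) :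
    ∃ v : ι → K, v ≠ 0 ∧ (∀ i, i ∉ S → v i = 0) ∧ IsInvariantDir (∑ i ∈ S, C (a i) * X i ^ p + P₀) v := by
  obtain ⟨v, hv0, hvS, hv⟩ := exists_kernelVector_of_one_lt_card S hS b
  refine ⟨v, hv0, hvS, ?_⟩
  have hF : (∑ i ∈ S, C (a i) * X i ^ p : MvPolynomial ι K) = (∑ i ∈ S, C (b i) * X i) ^ p := by
    rw [← sum_C_mul_X_pow_char p S b]
    exact Finset.sum_congr rfl fun i hi => by rw [hb i hi]
  rw [hF]
  exact isInvariantDir_frobeniusForm p S b v hv hvS P₀ hP₀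

/-! ## The coordinate criterion (REMARK D's dictionary): `e_i` is an invariant direction of `F` iff `X_i` does not occur in `F` -/

/-- Rescaling the direction rescales the parameter: `F(X + t·(a v)) = F(X + (a t)·v)` (ours). [cite: Lang2002, Ch. IV §1] -/
theorem lineShift_smul (a : K) (v : ι → K) (F : MvPolynomial ι K) :
    lineShift (a • v) F =
      Polynomial.aeval (Polynomial.C (C a) * Polynomial.X : Polynomial (MvPolynomial ι K)) (lineShift v F) := by
  have key : (lineShift (a • v) : MvPolynomial ι K →ₐ[K] Polynomial (MvPolynomial ι K)) =
      ((Polynomial.aeval (Polynomial.C (C a) * Polynomial.X : Polynomial (MvPolynomial ι K))).restrictScalars K).comp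
        (lineShift v) := by
    refine MvPolynomial.algHom_ext fun i => ?_
    simp only [lineShift_X, AlgHom.coe_comp, AlgHom.coe_restrictScalars', Function.comp_apply, map_add, map_mul,
      Polynomial.aeval_C, Polynomial.aeval_X, Polynomial.algebraMap_eq, Pi.smul_apply, smul_eq_mul]
    ring
  exact congrArg (fun φ : MvPolynomial ι K →ₐ[K] Polynomial (MvPolynomial ι K) => φ F) key

/-- Invariant directions are stable under scaling (ours): `F(X + t v) = F ⇒ F(X + t (a v)) = F`. [cite: Lang2002, Ch. IV §1] -/
theorem IsInvariantDir.smul {F : MvPolynomial ι K} {v : ι → K} (h : IsInvariantDir F v) (a : K) : IsInvariantDir F (a • v) := by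
  unfold IsInvariantDir at h ⊢
  rw [lineShift_smul, h, Polynomial.aeval_C, Polynomial.algebraMap_eq]

omit [CommRing K] in
/-- The variables of `X_j` lie in `{j}` (no `Nontrivial` hypothesis; ours, bookkeeping). [cite: Lang2002, Ch. IV §1] -/
theorem eq_of_mem_vars_X [CommSemiring K] {i j : ι} (h : i ∈ (X j : MvPolynomial ι K).vars) : i = j := by
  classical
  rw [MvPolynomial.mem_vars_iff_mem_support] at h
  obtain ⟨d, hd, hid⟩ := h
  have hd' : d = Finsupp.single j 1 := by
    have := MvPolynomial.support_monomial_subset (s := Finsupp.single j 1) (a := (1 : K)) (by simpa [X, monomial] using hd)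
    simpa using this
  subst hd'
  by_contra hne
  rw [Finsupp.mem_support_iff, Finsupp.single_apply, if_neg (Ne.symm hne)] at hid
  exact hid rfl

/-- Killing the variable `X_i` (substituting `X_i := 0`) produces a polynomial without `X_i` (ours, bookkeeping). [cite: Lang2002, Ch. IV §1] -/
theorem notMem_vars_bind₁_kill [DecidableEq ι] (F : MvPolynomial ι K) (i : ι) :
    i ∉ (bind₁ (fun j => if j = i then (0 : MvPolynomial ι K) else X j) F).vars := by
  intro hi
  have h := MvPolynomial.vars_bind₁ (fun j => if j = i then (0 : MvPolynomial ι K) else X j) F hi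
  simp only [Finset.mem_biUnion] at h
  obtain ⟨j, -, hj⟩ := h
  by_cases hji : j = i
  · simp [hji] at hj
  · rw [if_neg hji] at hj
    exact hji (eq_of_mem_vars_X hj).symm

/-- **Criterion, hard direction** (ours): if the coordinate direction `e_i` is an invariant direction of `F` — `F(…, X_i + t, …) = F` —
then `X_i` does not occur in `F` (any commutative coefficient ring; in characteristic `p` this uses ALL Taylor coefficients along
`e_i`, not only `∂_i F = 0`).  Proof: kill `X_i` coefficientwise and re-substitute `t := X_i`. [cite: Lang2002, Ch. IV §1] -/
theorem notMem_vars_of_isInvariantDir_single_one [DecidableEq ι] (F : MvPolynomial ι K) (i : ι)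
    (h : IsInvariantDir F (Pi.single i 1)) : i ∉ F.vars := by
  -- the substitution `X_i := 0`
  let kill : MvPolynomial ι K →ₐ[K] MvPolynomial ι K := bind₁ fun j => if j = i then (0 : MvPolynomial ι K) else X j
  have kill_X : ∀ j, kill (X j) = if j = i then (0 : MvPolynomial ι K) else X j := fun j => bind₁_X_right _ j
  -- `Θ = (t := X_i) ∘ (coefficientwise kill) ∘ (X ↦ X + t e_i)` is the identity of `K[X]`
  let Θ : MvPolynomial ι K →ₐ[K] MvPolynomial ι K :=
    ((Polynomial.aeval (X i : MvPolynomial ι K)).restrictScalars K).comp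
      ((Polynomial.mapAlgHom kill).comp (lineShift (Pi.single i (1 : K))))
  have Θ_apply : ∀ G, Θ G = Polynomial.aeval (X i : MvPolynomial ι K)
      (Polynomial.map (kill : MvPolynomial ι K →+* MvPolynomial ι K) (lineShift (Pi.single i (1 : K)) G)) := fun G => rfl
  have hΘid : Θ = AlgHom.id K (MvPolynomial ι K) := by
    refine MvPolynomial.algHom_ext fun j => ?_
    rw [Θ_apply, AlgHom.coe_id, id_eq, lineShift_X, Polynomial.map_add, Polynomial.map_mul, Polynomial.map_C, Polynomial.map_X,
      Polynomial.map_C, map_add, map_mul, Polynomial.aeval_C, Polynomial.aeval_X, Polynomial.aeval_C, Algebra.algebraMap_self,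
      RingHom.id_apply, RingHom.id_apply, RingHom.coe_coe, kill_X, MvPolynomial.algHom_C]
    by_cases hji : j = i
    · subst hji
      simp
    · rw [if_neg hji, Pi.single_apply, if_neg hji, map_zero, mul_zero, add_zero]
  have hF : Θ F = F := by rw [hΘid, AlgHom.coe_id, id_eq]
  have hΘF : Θ F = kill F := by
    rw [Θ_apply, show lineShift (Pi.single i (1 : K)) F = Polynomial.C F from h, Polynomial.map_C, Polynomial.aeval_C,
      Algebra.algebraMap_self, RingHom.id_apply]
    rfl
  rw [← hF, hΘF]
  exact notMem_vars_bind₁_kill F i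

/-- **Coordinate criterion** (REMARK D's dictionary "F∘A involves `f_i` iff `Ae_i` is not an invariant direction of `F`", case `A = id`;
ours): over a field and for `c ≠ 0`, `c·e_i` is an invariant direction of `F` iff `X_i` does not occur in `F`. [cite: Lang2002, Ch. IV §1] -/
theorem isInvariantDir_single_iff {L : Type*} [Field L] [DecidableEq ι] (F : MvPolynomial ι L) (i : ι) {c : L} (hc : c ≠ 0) :
    IsInvariantDir F (Pi.single i c) ↔ i ∉ F.vars := by
  constructor
  · intro h
    have e : (c⁻¹ • Pi.single i c : ι → L) = Pi.single i 1 := by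
      funext j
      by_cases hj : j = i
      · subst hj
        simp [hc]
      · simp [hj]
    have h1 : IsInvariantDir F (Pi.single i 1) := e ▸ h.smul c⁻¹
    exact notMem_vars_of_isInvariantDir_single_one F i h1
  · intro h
    exact isInvariantDir_single_of_notMem_vars F h c

/-! ## REMARK D, `f`-side: "`F∘A` involves `f_i` iff `A e_i` is not an invariant direction of `F`" -/

section LinSubst

variable [Fintype ι]

/-- The linear substitution `X_j ↦ Σ_k A_{jk} X_k`, i.e. `F ↦ F∘A`, `(F∘A)(X) = F(AX)` (ours, bookkeeping). [cite: Lang2002, Ch. IV §1] -/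
noncomputable def linSubst (A : ι → ι → K) : MvPolynomial ι K →ₐ[K] MvPolynomial ι K :=
  MvPolynomial.aeval fun j => ∑ k, C (A j k) * X k

/-- `linSubst` on a variable (ours, bookkeeping). [cite: Lang2002, Ch. IV §1] -/
@[simp] theorem linSubst_X (A : ι → ι → K) (j : ι) : linSubst A (X j : MvPolynomial ι K) = ∑ k, C (A j k) * X k := by
  simp [linSubst]

/-- **Conjugation identity** (ours): `(F∘A)(X + t e_i) = F(AX + t·Ae_i)`, i.e. shifting `F∘A` along `e_i` is shifting `F` along the
column `A e_i` followed by `∘A` coefficientwise. [cite: Lang2002, Ch. IV §1] -/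
theorem lineShift_single_linSubst [DecidableEq ι] (A : ι → ι → K) (i : ι) (F : MvPolynomial ι K) :
    lineShift (Pi.single i 1) (linSubst A F) =
      Polynomial.map (linSubst A : MvPolynomial ι K →+* MvPolynomial ι K) (lineShift (fun j => A j i) F) := by
  have key : (lineShift (Pi.single i (1 : K))).comp (linSubst A) =
      (Polynomial.mapAlgHom (linSubst A)).comp (lineShift fun j => A j i) := by
    refine MvPolynomial.algHom_ext fun j => ?_
    have hsum : ∑ k, A j k * (Pi.single i (1 : K) : ι → K) k = A j i := by
      rw [Finset.sum_eq_single i (fun k _ hk => by rw [Pi.single_apply, if_neg hk, mul_zero])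
        (fun h => absurd (Finset.mem_univ i) h), Pi.single_apply, if_pos rfl, mul_one]
    rw [AlgHom.comp_apply, AlgHom.comp_apply, linSubst_X, lineShift_linearForm, hsum, lineShift_X, Polynomial.coe_mapAlgHom,
      Polynomial.map_add, Polynomial.map_mul, Polynomial.map_C, Polynomial.map_X, Polynomial.map_C, RingHom.coe_coe, linSubst_X]
    simp [MvPolynomial.algHom_C, MvPolynomial.algebraMap_eq]
  have := congrArg (fun φ : MvPolynomial ι K →ₐ[K] Polynomial (MvPolynomial ι K) => φ F) key
  simpa only [AlgHom.comp_apply, Polynomial.coe_mapAlgHom] using this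

/-- For an injective linear substitution (e.g. `A` invertible): `e_i` is an invariant direction of `F∘A` iff the column `A e_i` is an
invariant direction of `F` (ours). [cite: Lang2002, Ch. IV §1] -/
theorem isInvariantDir_linSubst_single_iff [DecidableEq ι] (A : ι → ι → K) (hA : Function.Injective (linSubst A))
    (F : MvPolynomial ι K) (i : ι) :
    IsInvariantDir (linSubst A F) (Pi.single i 1) ↔ IsInvariantDir F (fun j => A j i) := by
  unfold IsInvariantDir
  rw [lineShift_single_linSubst]
  have hC : Polynomial.C (linSubst A F) =
      Polynomial.map (linSubst A : MvPolynomial ι K →+* MvPolynomial ι K) (Polynomial.C F) := by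
    rw [Polynomial.map_C, RingHom.coe_coe]
  rw [hC]
  exact (Polynomial.map_injective (linSubst A : MvPolynomial ι K →+* MvPolynomial ι K) hA).eq_iff

/-- **REMARK D, `f`-side dictionary** (THEOREM-LT §12; ours as a formal statement): over a field, for an injective linear substitution
`A`, the variable `X_i` OCCURS in `F∘A` iff the column `A e_i` is NOT an invariant direction of `F` — so "the pins of an `f`-coordinate
in `g∘Π` are the monomials of `F∘A` containing it" makes `(P)` a finite list of translation tests. [cite: Lang2002, Ch. IV §1] -/
theorem mem_vars_linSubst_iff {L : Type*} [Field L] [DecidableEq ι] (A : ι → ι → L)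
    (hA : Function.Injective (linSubst A)) (F : MvPolynomial ι L) (i : ι) :
    i ∈ (linSubst A F).vars ↔ ¬ IsInvariantDir F (fun j => A j i) := by
  rw [← isInvariantDir_linSubst_single_iff A hA F i, isInvariantDir_single_iff _ _ (one_ne_zero' L), not_not]

end LinSubst

/-! ## COROLLARY B⁗′(b), invariant-direction half: `F = a X_i^p + F₀(X″)` -/

/-- **B⁗′(b), construction** (ours; any commutative ring): if `F₀` does not involve `X_i`, `v″` vanishes at `i` and is ADDITIVE for `F₀`
— `F₀(X + t v″) = F₀(X) + t^p·F₀(v″)` — and `a r^p + F₀(v″) = 0`, then `v := v″ + r e_i` is an invariant direction of `a X_i^p + F₀`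
in characteristic `p` (the engine's "`v := ((−F₀(v″)/a)^{1/p}, v″)` would be invariant"). [cite: Lang2002, Ch. IV §1] -/
theorem isInvariantDir_of_additive [DecidableEq ι] (p : ℕ) [Fact p.Prime] [CharP K p] (a : K) (i : ι) (F₀ : MvPolynomial ι K)
    (hF₀ : i ∉ F₀.vars) (v'' : ι → K) (hv'' : v'' i = 0)
    (hadd : lineShift v'' F₀ = Polynomial.C F₀ + Polynomial.X ^ p * Polynomial.C (C (MvPolynomial.aeval v'' F₀)))
    (r : K) (hr : a * r ^ p + MvPolynomial.aeval v'' F₀ = 0) :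
    IsInvariantDir (C a * X i ^ p + F₀) (v'' + Pi.single i r) := by
  unfold IsInvariantDir
  -- `F₀` only sees `v″`: the two directions agree on `vars F₀`
  have hF₀shift : lineShift (v'' + Pi.single i r : ι → K) F₀ = lineShift v'' F₀ :=
    lineShift_congr_vars _ _ F₀ fun j hj => by
      have hji : j ≠ i := fun h => hF₀ (h ▸ hj)
      simp [hji]
  have hvi : (v'' + Pi.single i r : ι → K) i = r := by simp [hv'']
  rw [map_add, map_mul, map_pow, lineShift_C, lineShift_X, hvi, hF₀shift, hadd, add_pow_char _ _ p,
    ← Polynomial.C_pow, mul_pow, ← Polynomial.C_pow, ← C_pow]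
  -- collect: `C a·X_i^p + F₀ + t^p·(a r^p + F₀(v″)) = C a·X_i^p + F₀`
  have hr' : C a * C (r ^ p) + C (MvPolynomial.aeval v'' F₀) = (0 : MvPolynomial ι K) := by
    rw [← C_mul, ← C_add, hr, C_0]
  have : Polynomial.C (C a) * (Polynomial.X ^ p * Polynomial.C (C (r ^ p))) +
      Polynomial.X ^ p * Polynomial.C (C (MvPolynomial.aeval v'' F₀)) = (0 : Polynomial (MvPolynomial ι K)) := by
    rw [← mul_assoc, mul_comm (Polynomial.C (C a)) (Polynomial.X ^ p), mul_assoc, ← mul_add, ← Polynomial.C_mul, ← Polynomial.C_add,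
      hr', Polynomial.C_0, mul_zero]
  simp only [map_add, map_mul, map_pow] at this ⊢
  linear_combination this

/-- **B⁗′(b), necessity of `v″ ≠ 0`** (ours): if `F₀` does not involve `X_i` and `a ≠ 0`, then no non-zero multiple of `e_i` is an
invariant direction of `a X_i^p + F₀` ("conversely an invariant `v` has `v″ ≠ 0` since `a ≠ 0`"). [cite: Lang2002, Ch. IV §1] -/
theorem eq_zero_of_isInvariantDir_single [DecidableEq ι] [IsReduced K] (p : ℕ) [Fact p.Prime] [CharP K p] {a : K}
    (ha : ∀ x : K, a * x = 0 → x = 0) (i : ι) (F₀ : MvPolynomial ι K) (hF₀ : i ∉ F₀.vars) {c : K}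
    (h : IsInvariantDir (C a * X i ^ p + F₀) (Pi.single i c)) : c = 0 := by
  unfold IsInvariantDir at h
  rw [map_add, map_mul, map_pow, lineShift_C, lineShift_X, lineShift_eq_C_of_vars (Pi.single i c) F₀
      (fun j hj => by have hji : j ≠ i := fun e => hF₀ (e ▸ hj); simp [hji]),
    add_pow_char _ _ p, mul_pow, ← Polynomial.C_pow, ← Polynomial.C_pow, ← C_pow] at h
  -- compare the `t^p`-coefficients: `a c^p = 0`
  have hc := congrArg (fun P : Polynomial (MvPolynomial ι K) => P.coeff p) h
  have hp0 : p ≠ 0 := (Fact.out : p.Prime).ne_zero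
  simp only [Pi.single_eq_same, mul_add, Polynomial.coeff_add, Polynomial.coeff_C_mul, Polynomial.coeff_C, if_neg hp0,
    Polynomial.coeff_X_pow_mul', le_refl, if_true, Nat.sub_self, mul_zero, zero_add, add_zero] at hc
  rw [← C_mul, C_eq_zero] at hc
  exact pow_eq_zero_iff hp0 |>.mp (ha _ hc)

/-! ## The top Taylor coefficient along `v` and the converse half of COROLLARY B⁗′ (b) -/

section TopCoeff

/-- `lineShift` of a monomial: `c · Π_i (C X_i + t·C (C v_i))^{m_i}` (ours, bookkeeping). [cite: Lang2002, Ch. IV §1] -/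
theorem lineShift_monomial (v : ι → K) (m : ι →₀ ℕ) (c : K) :
    lineShift v (monomial m c) =
      Polynomial.C (C c) * ∏ i ∈ m.support, (Polynomial.C (X i) + Polynomial.X * Polynomial.C (C (v i))) ^ m i := by
  rw [lineShift, MvPolynomial.aeval_monomial, Finsupp.prod, Polynomial.algebraMap_apply, MvPolynomial.algebraMap_eq]

/-- `F(X + t v)` of a monomial of degree `|m|`: `t`-degree `≤ |m|`, top coefficient `C (c · v^m)` (ours). [cite: Lang2002, Ch. IV §1] -/
theorem natDegree_lineShift_monomial_le (v : ι → K) (m : ι →₀ ℕ) (c : K) :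
    (lineShift v (monomial m c)).natDegree ≤ m.degree ∧
      (lineShift v (monomial m c)).coeff m.degree = C c * ∏ i ∈ m.support, C (v i) ^ m i := by
  classical
  -- the linear factors have degree `≤ 1`
  have hlin : ∀ i, (Polynomial.C (X i) + Polynomial.X * Polynomial.C (C (v i)) : Polynomial (MvPolynomial ι K)).natDegree ≤ 1 :=
    fun i => (Polynomial.natDegree_add_le _ _).trans
      (max_le (by simp) (Polynomial.natDegree_mul_le.trans (by simpa using Polynomial.natDegree_X_le)))
  -- a product of polynomials of degrees `≤ d_i`: degree `≤ Σ d_i`, top coefficient = product of the top coefficients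
  have hprod : ∀ (s : Finset ι) (P : ι → Polynomial (MvPolynomial ι K)) (d : ι → ℕ), (∀ i ∈ s, (P i).natDegree ≤ d i) →
      (∏ i ∈ s, P i).natDegree ≤ ∑ i ∈ s, d i ∧ (∏ i ∈ s, P i).coeff (∑ i ∈ s, d i) = ∏ i ∈ s, (P i).coeff (d i) := by
    intro s P d h
    induction s using Finset.induction_on with
    | empty => simp
    | insert a s ha ih =>
        obtain ⟨ih1, ih2⟩ := ih fun i hi => h i (Finset.mem_insert_of_mem hi)
        have hPa := h a (Finset.mem_insert_self a s)
        rw [Finset.prod_insert ha, Finset.sum_insert ha, Finset.prod_insert ha]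
        refine ⟨Polynomial.natDegree_mul_le.trans (add_le_add hPa ih1), ?_⟩
        rw [Polynomial.coeff_mul_add_eq_of_natDegree_le hPa ih1, ih2]
  have hfac : ∀ i ∈ m.support, ((Polynomial.C (X i) + Polynomial.X * Polynomial.C (C (v i))) ^ m i).natDegree ≤ m i := by
    intro i _
    refine Polynomial.natDegree_pow_le.trans ?_
    simpa using Nat.mul_le_mul_left (m i) (hlin i)
  obtain ⟨h1, h2⟩ := hprod m.support _ (fun i => m i) hfac
  have hdeg : m.degree = ∑ i ∈ m.support, m i := Finsupp.degree_apply m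
  rw [lineShift_monomial, hdeg]
  refine ⟨(Polynomial.natDegree_C_mul_le _ _).trans h1, ?_⟩
  rw [Polynomial.coeff_C_mul, h2]
  congr 1
  refine Finset.prod_congr rfl fun i _ => ?_
  have := Polynomial.coeff_pow_of_natDegree_le (m := m i) (hlin i)
  rw [mul_one] at this
  rw [this]
  simp

/-- The `t`-degree of `F(X + t v)` is at most the total degree of `F` (ours). [cite: Lang2002, Ch. IV §1] -/
theorem natDegree_lineShift_le (v : ι → K) (F : MvPolynomial ι K) : (lineShift v F).natDegree ≤ F.totalDegree := by
  conv_lhs => rw [F.as_sum]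
  rw [map_sum]
  refine Polynomial.natDegree_sum_le_of_forall_le _ _ fun m hm => ?_
  refine (natDegree_lineShift_monomial_le v m _).1.trans ?_
  rw [Finsupp.degree_apply]
  exact MvPolynomial.le_totalDegree hm

/-- **Top Taylor coefficient** (ours): for a FORM `F` of degree `n`, the `t^n`-coefficient of `F(X + t v)` is the constant `F(v)`.
[cite: Lang2002, Ch. IV §1] -/
theorem coeff_lineShift_of_isHomogeneous (v : ι → K) {F : MvPolynomial ι K} {n : ℕ} (hF : F.IsHomogeneous n) :
    (lineShift v F).coeff n = C (MvPolynomial.aeval v F) := by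
  classical
  conv_lhs => rw [F.as_sum]
  conv_rhs => rw [F.as_sum]
  rw [map_sum, map_sum, map_sum, Polynomial.finsetSum_coeff]
  refine Finset.sum_congr rfl fun m hm => ?_
  have hmn : m.degree = n := by
    by_contra hne
    exact (MvPolynomial.mem_support_iff.mp hm) (hF.coeff_eq_zero hne)
  change (lineShift v (monomial m _)).coeff n = _
  rw [← hmn, (natDegree_lineShift_monomial_le v m _).2, MvPolynomial.aeval_monomial, Finsupp.prod, map_mul, map_prod,
    Algebra.algebraMap_self, RingHom.id_apply]
  congr 1
  exact Finset.prod_congr rfl fun i _ => by rw [map_pow]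

/-- **COROLLARY B⁗′ (b), converse half** (ours as a formal statement; the engine's "⇒"): in characteristic `p`, if `F₀` is a FORM of
degree `p` not involving `X_i` and `v` is an invariant direction of `a X_i^p + F₀`, then with `r := v_i` and `v″ := v` with the `i`-th entry
zeroed: `a r^p + F₀(v″) = 0` AND `F₀` is ADDITIVE along `v″`, `F₀(X + t v″) = F₀(X) + t^p F₀(v″)`.  Together with
`isInvariantDir_of_additive` / `eq_zero_of_isInvariantDir_single`: `a X_i^p + F₀` (with `a` a non-zero-divisor) has a non-zero invariant
direction iff `F₀` is additive along some `v″ ≠ 0` with `−F₀(v″)/a` a `p`-th power. [cite: Lang2002, Ch. IV §1] -/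
theorem additive_of_isInvariantDir [DecidableEq ι] (p : ℕ) [Fact p.Prime] [CharP K p] (a : K) (i : ι) (F₀ : MvPolynomial ι K)
    (hF₀ : i ∉ F₀.vars) (hhom : F₀.IsHomogeneous p) (v : ι → K) (h : IsInvariantDir (C a * X i ^ p + F₀) v) :
    a * v i ^ p + MvPolynomial.aeval (Function.update v i 0) F₀ = 0 ∧
      lineShift (Function.update v i 0) F₀ =
        Polynomial.C F₀ + Polynomial.X ^ p * Polynomial.C (C (MvPolynomial.aeval (Function.update v i 0) F₀)) := by
  set v'' := Function.update v i 0 with hv''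
  unfold IsInvariantDir at h
  have hF₀shift : lineShift v F₀ = lineShift v'' F₀ :=
    lineShift_congr_vars _ _ F₀ fun j hj => by
      have hji : j ≠ i := fun e => hF₀ (e ▸ hj)
      simp [hv'', hji]
  rw [map_add, map_mul, map_pow, lineShift_C, lineShift_X, hF₀shift, add_pow_char _ _ p, mul_pow, ← Polynomial.C_pow,
    ← Polynomial.C_pow, ← C_pow, map_add, map_mul, map_pow] at h
  -- (E): `F₀(X + t v″) = F₀ − t^p · a v_i^p`
  have hE : lineShift v'' F₀ = Polynomial.C F₀ - Polynomial.X ^ p * Polynomial.C (C (a * v i ^ p)) := by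
    rw [C_mul, Polynomial.C_mul]
    linear_combination h
  -- compare `t^p`-coefficients: `F₀(v″) = − a v_i^p`
  have hp0 : p ≠ 0 := (Fact.out : p.Prime).ne_zero
  have htop := congrArg (fun P : Polynomial (MvPolynomial ι K) => P.coeff p) hE
  simp only [coeff_lineShift_of_isHomogeneous v'' hhom, Polynomial.coeff_sub, Polynomial.coeff_C, if_neg hp0,
    Polynomial.coeff_X_pow_mul', le_refl, if_true, Nat.sub_self, zero_sub] at htop
  have hval : MvPolynomial.aeval v'' F₀ = -(a * v i ^ p) := by
    rw [← map_neg C] at htop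
    exact C_injective _ _ htop
  refine ⟨by rw [hval]; ring, ?_⟩
  rw [hE, hval, map_neg C, map_neg Polynomial.C]
  ring

end TopCoeff

/-! ## PROPOSITION H's radical criterion (THEOREM-LT §13): the invariant directions of a quadratic form are its radical (`2 ≠ 0`) — v5 -/

section Quadratic

variable (S : Finset ι) (b : ι → ι → K)

/-- `q(X + t v) = q(X) + (Σ_{i,j∈S} b_{ij}(v_j X_i + v_i X_j))·t + q(v)·t²` for `q = Σ_{i,j∈S} b_{ij} X_i X_j` (ours). [cite: Lang2002, Ch. IV §1] -/
theorem lineShift_quadraticForm (v : ι → K) :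
    lineShift v (∑ i ∈ S, ∑ j ∈ S, C (b i j) * X i * X j) =
      Polynomial.C (∑ i ∈ S, ∑ j ∈ S, C (b i j) * X i * X j)
        + Polynomial.C (∑ i ∈ S, ∑ j ∈ S, C (b i j) * (C (v j) * X i + C (v i) * X j)) * Polynomial.X
        + Polynomial.C (C (∑ i ∈ S, ∑ j ∈ S, b i j * v i * v j)) * Polynomial.X ^ 2 := by
  simp only [map_sum, map_mul, map_add, lineShift_C, lineShift_X, Finset.sum_mul, ← Finset.sum_add_distrib]
  refine Finset.sum_congr rfl fun i _ => Finset.sum_congr rfl fun j _ => ?_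
  ring

/-- For a SYMMETRIC table the `t`-coefficient is the linear form `Σ_{i∈S} (2 Σ_{j∈S} b_{ij} v_j) X_i` ("`2B(X, v)`"; ours).
[cite: Lang2002, Ch. IV §1] -/
theorem polar_eq_linearForm (hb : ∀ i j, b i j = b j i) (v : ι → K) :
    (∑ i ∈ S, ∑ j ∈ S, C (b i j) * (C (v j) * X i + C (v i) * X j) : MvPolynomial ι K)
      = ∑ i ∈ S, C (2 * ∑ j ∈ S, b i j * v j) * X i := by
  have h1 : ∑ i ∈ S, ∑ j ∈ S, C (b i j) * (C (v i) * X j)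
      = ∑ i ∈ S, ∑ j ∈ S, (C (b i j) * (C (v j) * X i) : MvPolynomial ι K) := by
    rw [Finset.sum_comm]
    exact Finset.sum_congr rfl fun i _ => Finset.sum_congr rfl fun j _ => by rw [hb j i]
  have h2 : ∀ i ∈ S, (C (2 * ∑ j ∈ S, b i j * v j) * X i : MvPolynomial ι K)
      = ∑ j ∈ S, (C (b i j) * (C (v j) * X i) + C (b i j) * (C (v j) * X i)) := by
    intro i _
    rw [map_mul, map_sum, Finset.mul_sum, Finset.sum_mul]
    exact Finset.sum_congr rfl fun j _ => by rw [map_mul, map_ofNat C 2]; ring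
  simp only [mul_add, Finset.sum_add_distrib]
  rw [h1, Finset.sum_congr rfl h2]
  simp only [Finset.sum_add_distrib]

/-- A radical vector of `b|_{S×S}` is an invariant direction of the quadratic form (ours; any commutative ring, `b` symmetric).
[cite: Lang2002, Ch. IV §1] -/
theorem isInvariantDir_quadraticForm_of_radical (hb : ∀ i j, b i j = b j i) (v : ι → K)
    (hv : ∀ i ∈ S, ∑ j ∈ S, b i j * v j = 0) :
    IsInvariantDir (∑ i ∈ S, ∑ j ∈ S, C (b i j) * X i * X j) v := by
  unfold IsInvariantDir
  rw [lineShift_quadraticForm, polar_eq_linearForm S b hb v]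
  have hL : (∑ i ∈ S, C (2 * ∑ j ∈ S, b i j * v j) * X i : MvPolynomial ι K) = 0 :=
    Finset.sum_eq_zero fun i hi => by rw [hv i hi, mul_zero, C_0, zero_mul]
  have hQ : ∑ i ∈ S, ∑ j ∈ S, b i j * v i * v j = 0 :=
    Finset.sum_eq_zero fun i hi => by
      rw [show ∑ j ∈ S, b i j * v i * v j = v i * ∑ j ∈ S, b i j * v j from by
        rw [Finset.mul_sum]; exact Finset.sum_congr rfl fun j _ => by ring, hv i hi, mul_zero]
  rw [hL, hQ]
  simp

/-- **Radical criterion, hard direction** (ours): over a domain with `2 ≠ 0` and `b` symmetric, an invariant direction `v` of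
`Σ_{i,j∈S} b_{ij} X_i X_j` satisfies `Σ_{j∈S} b_{ij} v_j = 0` for every `i ∈ S` (the `t`-coefficient `2B(X, v)` vanishes).
[cite: Lang2002, Ch. IV §1] -/
theorem radical_of_isInvariantDir_quadraticForm [DecidableEq ι] [IsDomain K] (h2 : (2 : K) ≠ 0) (hb : ∀ i j, b i j = b j i)
    (v : ι → K) (h : IsInvariantDir (∑ i ∈ S, ∑ j ∈ S, C (b i j) * X i * X j) v) {i : ι} (hi : i ∈ S) :
    ∑ j ∈ S, b i j * v j = 0 := by
  unfold IsInvariantDir at h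
  rw [lineShift_quadraticForm, polar_eq_linearForm S b hb v, add_assoc, add_eq_left] at h
  have hL : (∑ i ∈ S, C (2 * ∑ j ∈ S, b i j * v j) * X i : MvPolynomial ι K) = 0 := by
    have h1 := (Polynomial.ext_iff.mp h) 1
    rwa [Polynomial.coeff_add, Polynomial.coeff_C_mul_X, Polynomial.coeff_C_mul_X_pow, Polynomial.coeff_zero, if_pos rfl,
      if_neg (by decide), add_zero] at h1
  have hc : 2 * ∑ j ∈ S, b i j * v j = 0 := by
    have h3 := congrArg (coeff (Finsupp.single i 1)) hL
    rw [coeff_sum, coeff_zero, Finset.sum_eq_single i (fun i' _ hne => ?_) (fun h => absurd hi h), coeff_C_mul, coeff_X,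
      if_pos rfl, mul_one] at h3
    · exact h3
    · rw [coeff_C_mul, coeff_X, if_neg (fun h => hne (Finsupp.single_left_injective one_ne_zero h)), mul_zero]
  exact (mul_eq_zero.mp hc).resolve_left h2

/-- **Radical criterion** (engine 1, PROPOSITION H: "`q₂` has no invariant direction ⇔ rad `B = 0`"; ours as a formal statement): over a
domain with `2 ≠ 0`, `v` is an invariant direction of `Σ_{i,j∈S} b_{ij} X_i X_j` (`b` symmetric) iff `Σ_{j∈S} b_{ij} v_j = 0` for all
`i ∈ S`. [cite: Lang2002, Ch. IV §1] -/
theorem isInvariantDir_quadraticForm_iff [DecidableEq ι] [IsDomain K] (h2 : (2 : K) ≠ 0) (hb : ∀ i j, b i j = b j i) (v : ι → K) :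
    IsInvariantDir (∑ i ∈ S, ∑ j ∈ S, C (b i j) * X i * X j) v ↔ ∀ i ∈ S, ∑ j ∈ S, b i j * v j = 0 :=
  ⟨fun h _ hi => radical_of_isInvariantDir_quadraticForm S b h2 hb v h hi,
    isInvariantDir_quadraticForm_of_radical S b hb v⟩

/-- A left inverse of `b|_{S×S}` (the nondegeneracy hypothesis of `WeightedCentreQuadraticSpectator.delta_eq_zero_of_fix`) kills the
radical on `S`: `Σ_j b'_{ij} b_{jk} = δ_{ik}` and `Σ_j b_{kj} v_j = 0` (`k ∈ S`) give `v_i = 0` (`i ∈ S`) — so then the only invariant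
directions of the form vanish on `S` (ours). [cite: Lang2002, Ch. III §5] -/
theorem eq_zero_of_radical_of_leftInverse [DecidableEq ι] (b' : ι → ι → K)
    (hb' : ∀ i ∈ S, ∀ k ∈ S, ∑ j ∈ S, b' i j * b j k = if i = k then 1 else 0) (v : ι → K)
    (hv : ∀ k ∈ S, ∑ j ∈ S, b k j * v j = 0) {i : ι} (hi : i ∈ S) : v i = 0 := by
  calc v i = ∑ k ∈ S, (if i = k then 1 else 0) * v k := by
        simp only [ite_mul, one_mul, zero_mul, Finset.sum_ite_eq, if_pos hi]
    _ = ∑ k ∈ S, (∑ j ∈ S, b' i j * b j k) * v k := Finset.sum_congr rfl fun k hk => by rw [hb' i hi k hk]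
    _ = ∑ j ∈ S, b' i j * ∑ k ∈ S, b j k * v k := by
        simp only [Finset.sum_mul, Finset.mul_sum, mul_assoc]
        exact Finset.sum_comm
    _ = 0 := Finset.sum_eq_zero fun j hj => by rw [hv j hj, mul_zero]

/-- **"`q₂∘A` involves `f_i` ⇔ `Ae_i ∉ rad B`"** (PROPOSITION H's middle step via REMARK D; ours): over a field with `2 ≠ 0`, for an
injective linear substitution `A` and symmetric `b`, `X_i` occurs in `(Σ_{j,k∈S} b_{jk} X_j X_k)∘A` iff the column `Ae_i` is not
`b`-orthogonal to `S`. [cite: Lang2002, Ch. IV §1] -/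
theorem mem_vars_linSubst_quadraticForm_iff {L : Type*} [Field L] [Fintype ι] [DecidableEq ι] (h2 : (2 : L) ≠ 0)
    (b : ι → ι → L) (hb : ∀ i j, b i j = b j i) (A : ι → ι → L) (hA : Function.Injective (linSubst A)) (i : ι) :
    i ∈ (linSubst A (∑ j ∈ S, ∑ k ∈ S, C (b j k) * X j * X k)).vars ↔ ¬ ∀ k ∈ S, ∑ j ∈ S, b k j * A j i = 0 := by
  rw [mem_vars_linSubst_iff A hA, isInvariantDir_quadraticForm_iff S b h2 hb]

end Quadratic

/-! ## The GL-move `v ↦ e_i` and "(P) ⇔ no invariant direction" (PROP F / B⁗ (i) / PROP H; v6) -/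

section GLMove

variable [Fintype ι] [DecidableEq ι]

/-- `F∘1 = F` (bookkeeping). [cite: Lang2002, Ch. IV §1] -/
theorem linSubst_one : linSubst (fun j k => (1 : Matrix ι ι K) j k) = AlgHom.id K (MvPolynomial ι K) := by
  refine MvPolynomial.algHom_ext fun j => ?_
  rw [linSubst_X, AlgHom.coe_id, id_eq, Finset.sum_eq_single j (fun k _ hk => by rw [Matrix.one_apply_ne (Ne.symm hk), C_0, zero_mul])
    (fun h => absurd (Finset.mem_univ j) h), Matrix.one_apply_eq, C_1, one_mul]

omit [DecidableEq ι] in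
/-- **Composition** `(F∘B)∘A = F∘(B·A)`: `linSubst A (linSubst B F) = linSubst (B * A) F` (bookkeeping). [cite: Lang2002, Ch. IV §1] -/
theorem linSubst_linSubst (A B : Matrix ι ι K) (F : MvPolynomial ι K) :
    linSubst (fun j k => A j k) (linSubst (fun j k => B j k) F) = linSubst (fun j k => (B * A) j k) F := by
  have key : (linSubst fun j k => A j k).comp (linSubst fun j k => B j k) = linSubst (K := K) fun j k => (B * A) j k := by
    refine MvPolynomial.algHom_ext fun j => ?_
    rw [AlgHom.comp_apply, linSubst_X, linSubst_X, map_sum]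
    simp only [map_mul, MvPolynomial.algHom_C, MvPolynomial.algebraMap_eq, linSubst_X, Matrix.mul_apply, map_sum, Finset.mul_sum,
      Finset.sum_mul]
    rw [Finset.sum_comm]
    refine Finset.sum_congr rfl fun l _ => Finset.sum_congr rfl fun m _ => ?_
    exact (mul_assoc _ _ _).symm
  simpa only [AlgHom.comp_apply] using congrArg (fun φ : MvPolynomial ι K →ₐ[K] MvPolynomial ι K => φ F) key

/-- `A · A' = 1` ⇒ `F ↦ F∘A` is injective (`F∘A∘A' = F`; bookkeeping). [cite: Lang2002, Ch. IV §1] -/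
theorem linSubst_injective_of_mul_eq_one (A A' : Matrix ι ι K) (h : A * A' = 1) :
    Function.Injective (linSubst fun j k => A j k) := by
  intro F G hFG
  have := congrArg (linSubst fun j k => A' j k) hFG
  rwa [linSubst_linSubst, linSubst_linSubst, h, linSubst_one, AlgHom.coe_id, id_eq, id_eq] at this

/-- `det (1 with column i replaced by u) = u i` (Cramer; bookkeeping). [cite: Lang2002, Ch. XIII §4] -/
theorem det_updateCol_one (u : ι → K) (i : ι) : ((1 : Matrix ι ι K).updateCol i u).det = u i := by
  rw [← Matrix.cramer_apply, Matrix.cramer_one]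
  rfl

/-- **The GL-move `v ↦ e_i`** (ours, elementary): over a field every nonzero vector is the `i`-th column of an invertible matrix (the identity with
column `i` replaced by `v`, corrected by one transvection when `v_i = 0`). [cite: Lang2002, Ch. XIII §4] -/
theorem exists_mul_eq_one_col_eq {L : Type*} [Field L] (v : ι → L) (hv : v ≠ 0) (i : ι) :
    ∃ A A' : Matrix ι ι L, A * A' = 1 ∧ A' * A = 1 ∧ ∀ r, A r i = v r := by
  have finish : ∀ A : Matrix ι ι L, A.det ≠ 0 → (∀ r, A r i = v r) →
      ∃ A A' : Matrix ι ι L, A * A' = 1 ∧ A' * A = 1 ∧ ∀ r, A r i = v r := fun A hA hcol =>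
    ⟨A, A⁻¹, Matrix.mul_nonsing_inv A (isUnit_iff_ne_zero.mpr hA), Matrix.nonsing_inv_mul A (isUnit_iff_ne_zero.mpr hA), hcol⟩
  obtain ⟨j₀, hj₀⟩ := Function.ne_iff.mp hv
  rw [Pi.zero_apply] at hj₀
  by_cases hji : j₀ = i
  · subst hji
    exact finish ((1 : Matrix ι ι L).updateCol j₀ v) (by rw [det_updateCol_one]; exact hj₀) fun r => Matrix.updateCol_self
  · set v' : ι → L := Function.update v i (v j₀) with hv'
    set B : Matrix ι ι L := (1 : Matrix ι ι L).updateCol i v' with hB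
    have hBcol : ∀ r, B r i = v' r := fun r => Matrix.updateCol_self
    refine finish (Matrix.transvection i j₀ ((v i - v j₀) / v j₀) * B) ?_ fun r => ?_
    · rw [Matrix.det_mul, Matrix.det_transvection_of_ne i j₀ (Ne.symm hji), one_mul, hB, det_updateCol_one, hv',
        Function.update_self]
      exact hj₀
    · by_cases hr : r = i
      · rw [hr, Matrix.transvection_mul_apply_same i j₀ i _ B, hBcol, hBcol, hv', Function.update_self, Function.update_of_ne hji]
        field_simp
        ring
      · rw [Matrix.transvection_mul_apply_of_ne i j₀ r i hr _ B, hBcol, hv', Function.update_of_ne hr]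

/-- **(P) ⇒ no invariant direction** (REMARK D made global; the step "in coordinates with `v₀ = e₁` … `f₁` is unpinned — contradicting (P)" of
PROP F / B⁗ (i); ours): over a field, if `X_i` occurs in `F∘A` for EVERY invertible `A`, then `F` has no nonzero invariant direction.
[cite: Lang2002, Ch. IV §1] -/
theorem not_isInvariantDir_of_forall_mem_vars {L : Type*} [Field L] (F : MvPolynomial ι L) (i : ι)
    (hP : ∀ A A' : Matrix ι ι L, A * A' = 1 → A' * A = 1 → i ∈ (linSubst (fun j k => A j k) F).vars) {v : ι → L} (hv : v ≠ 0) :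
    ¬ IsInvariantDir F v := by
  obtain ⟨A, A', hA, hA', hcol⟩ := exists_mul_eq_one_col_eq v hv i
  have h := (mem_vars_linSubst_iff (fun j k => A j k) (linSubst_injective_of_mul_eq_one A A' hA) F i).mp (hP A A' hA hA')
  rwa [show (fun j => A j i) = v from funext hcol] at h

/-- A matrix with a left inverse has no zero column (bookkeeping). [cite: Lang2002, Ch. XIII §4] -/
theorem col_ne_zero_of_mul_eq_one [Nontrivial K] (A A' : Matrix ι ι K) (hA' : A' * A = 1) (i : ι) : (fun j => A j i) ≠ 0 := by
  intro h
  have h1 : (A' * A) i i = 1 := by rw [hA', Matrix.one_apply_eq]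
  rw [Matrix.mul_apply, Finset.sum_eq_zero fun m _ => by rw [show A m i = 0 from congrFun h m, mul_zero]] at h1
  exact zero_ne_one h1

/-- **No invariant direction ⇒ (P)** (the converse; ours): if `F` has no nonzero invariant direction, then every `X_i` occurs in `F∘A` for every
invertible `A`. [cite: Lang2002, Ch. IV §1] -/
theorem mem_vars_linSubst_of_forall_not_isInvariantDir {L : Type*} [Field L] (F : MvPolynomial ι L)
    (hF : ∀ v : ι → L, v ≠ 0 → ¬ IsInvariantDir F v) (A A' : Matrix ι ι L) (hA : A * A' = 1) (hA' : A' * A = 1) (i : ι) :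
    i ∈ (linSubst (fun j k => A j k) F).vars :=
  (mem_vars_linSubst_iff (fun j k => A j k) (linSubst_injective_of_mul_eq_one A A' hA) F i).mpr
    (hF _ (col_ne_zero_of_mul_eq_one A A' hA' i))

/-- **"(P) for the class ⇔ no invariant direction"** (REMARK D / PROP F's "[(P) ⇔ these two rigidity conditions]", `f`-side, as an iff over a
field; ours): every variable occurs in `F∘A` for every invertible `A` iff `F` has no nonzero invariant direction (for `ι` nonempty the slot index in
the hypothesis is immaterial). [cite: Lang2002, Ch. IV §1] -/
theorem forall_mem_vars_linSubst_iff {L : Type*} [Field L] [Nonempty ι] (F : MvPolynomial ι L) :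
    (∀ A A' : Matrix ι ι L, A * A' = 1 → A' * A = 1 → ∀ i, i ∈ (linSubst (fun j k => A j k) F).vars) ↔
      ∀ v : ι → L, v ≠ 0 → ¬ IsInvariantDir F v := by
  constructor
  · intro hP v hv
    obtain ⟨i⟩ := ‹Nonempty ι›
    exact not_isInvariantDir_of_forall_mem_vars F i (fun A A' hA hA' => hP A A' hA hA' i) hv
  · intro hF A A' hA hA' i
    exact mem_vars_linSubst_of_forall_not_isInvariantDir F hF A A' hA hA' i

/-- **THEOREM B⁗ (i) RANK ONE under the formal (P)** (THEOREM-LT §12: "if `r ≥ 2` pick `v ≠ 0` in `span(e₁,…,e_r)` with `𝓊(v) = 0` … in the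
`f`-basis containing `v` the `v`-coordinate occurs in no monomial of `P` — it has no pin: ¬(P). So `r = 1`"; ours as a formal statement): over a field of
characteristic `p`, if the diagonal coefficients on `S` are `p`-th powers, `P₀` is free of the `S`-variables, and SOME variable occurs in `(Σ_{i∈S} a_i X_i^p + P₀)∘A`
for every invertible `A`, then `|S| ≤ 1`. [cite: Lang2002, Ch. V §6] -/
theorem card_le_one_of_forall_mem_vars {L : Type*} [Field L] (p : ℕ) [Fact p.Prime] [CharP L p] (S : Finset ι) (a b : ι → L)
    (hb : ∀ i ∈ S, b i ^ p = a i) (P₀ : MvPolynomial ι L) (hP₀ : ∀ i ∈ S, i ∉ P₀.vars) (i₀ : ι)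
    (hP : ∀ A A' : Matrix ι ι L, A * A' = 1 → A' * A = 1 → i₀ ∈ (linSubst (fun j k => A j k) (∑ i ∈ S, C (a i) * X i ^ p + P₀)).vars) :
    S.card ≤ 1 := by
  by_contra hS
  obtain ⟨v, hv0, -, hv⟩ := exists_isInvariantDir_of_two_le_card p S (by omega) a b hb P₀ hP₀
  exact not_isInvariantDir_of_forall_mem_vars _ i₀ hP hv0 hv

end GLMove

/-! ## THEOREM B⁗ (i)–(ii) FROBENIUS SPLITTING, derived (v8): `∂_i P = 0` on `S` at the value `p·w_i` ⇒ `P = Σ_{i∈S} a_i X_i^p + P₀(X″)`;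
RANK ONE from `D P = 0` with `D = Σ_a ℓ_a(W) ∂_{f_a}` -/

section FrobeniusSplitting

variable {L : Type*} [Field L] (p : ℕ) [hp : Fact p.Prime] [CharP L p]

omit hp in
/-- In characteristic `p`: if `∂_i P = 0` then every exponent of `X_i` occurring in `P` is a multiple of `p` (ours, re-derived here;
cf. `G28Face.dvd_of_pderiv_eq_zero`). [cite: Lang2002, Ch. V §6] -/
theorem dvd_of_pderiv_eq_zero [DecidableEq ι] {P : MvPolynomial ι L} {i : ι} (h : pderiv i P = 0) {m : ι →₀ ℕ}
    (hm : m ∈ P.support) : p ∣ m i := by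
  by_cases hmi : m i = 0
  · rw [hmi]; exact dvd_zero p
  have htm : m - Finsupp.single i 1 + Finsupp.single i 1 = m :=
    tsub_add_cancel_of_le (Finsupp.single_le_iff.mpr (Nat.one_le_iff_ne_zero.mpr hmi))
  have hti : (m - Finsupp.single i 1 : ι →₀ ℕ) i + 1 = m i := by
    rw [Finsupp.tsub_apply, Finsupp.single_eq_same]; omega
  have hc := coeff_pderiv_eq i P (m - Finsupp.single i 1)
  rw [h, coeff_zero, htm, hti] at hc
  rcases mul_eq_zero.mp hc.symm with h1 | h1
  · exact (CharP.cast_eq_zero_iff L p (m i)).mp h1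
  · exact absurd h1 (mem_support_iff.mp hm)

omit hp in
/-- `n ∉ vars P ⇒ n ∉ vars (∂_i P)` (ours; bookkeeping). [cite: Lang2002, Ch. IV §1] -/
theorem notMem_vars_pderiv [DecidableEq ι] {P : MvPolynomial ι L} {n : ι} (i : ι) (h : n ∉ P.vars) :
    n ∉ (pderiv i P).vars := by
  rw [mem_vars_iff_mem_support] at h ⊢
  rintro ⟨m, hm, hnm⟩
  apply h
  refine ⟨m + Finsupp.single i 1, ?_, ?_⟩
  · rw [mem_support_iff] at hm ⊢
    rw [coeff_pderiv_eq] at hm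
    exact fun h0 => hm (by rw [h0, mul_zero])
  · rw [Finsupp.mem_support_iff] at hnm ⊢
    rw [Finsupp.add_apply]
    omega

/-- **The Frobenius-splitting step, one monomial** (THEOREM-LT §12 (i): "`∂_{f_i}P = 0` … `P ∈ k[f_i^p, f″, V]`, and since `f_i^p` already has
value 1 …"; ours as a formal statement): in characteristic `p`, for `P` weighted homogeneous of weight `μ = p·w_i` (positive weights) with
`∂_i P = 0`, the only monomial of `P` containing `X_i` is `X_i^p`. [cite: Lang2002, Ch. V §6] -/
theorem eq_single_of_pderiv_eq_zero [DecidableEq ι] {w : ι → ℚ} (hw : ∀ j, 0 < w j) {μ : ℚ} {P : MvPolynomial ι L}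
    (hP : IsWeightedHomogeneous w P μ) {i : ι} (hi : (p : ℚ) * w i = μ) (hD : pderiv i P = 0) {m : ι →₀ ℕ}
    (hm : m ∈ P.support) (hmi : m i ≠ 0) : m = Finsupp.single i p := by
  have hwt : Finsupp.weight w m = μ := hP (mem_support_iff.mp hm)
  obtain ⟨c, hc⟩ := dvd_of_pderiv_eq_zero p hD hm
  have hc1 : 1 ≤ c := Nat.one_le_iff_ne_zero.mpr fun h0 => hmi (by rw [hc, h0, mul_zero])
  -- positive weights: `(d j) * w j ≤ weight d` and a weight-zero exponent vector is `0` (bookkeeping, inlined; the named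
  -- versions live in `WeightedCentreG28Isotropy` (`G28Face.natCast_mul_le_weight`, `G28Face.eq_zero_of_weight_eq_zero`)).
  have hle_of : ∀ (d : ι →₀ ℕ) (j : ι), (d j : ℚ) * w j ≤ Finsupp.weight w d := fun d j => by
    rw [Finsupp.weight_apply, Finsupp.sum]
    have hnn : ∀ l ∈ d.support, (0 : ℚ) ≤ d l • w l := fun l _ => by
      rw [nsmul_eq_mul]; exact mul_nonneg (Nat.cast_nonneg _) (hw l).le
    by_cases hj : j ∈ d.support
    · have h := Finset.single_le_sum (f := fun l => d l • w l) hnn hj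
      rwa [nsmul_eq_mul] at h
    · rw [Finsupp.notMem_support_iff.mp hj, Nat.cast_zero, zero_mul]
      exact Finset.sum_nonneg hnn
  have zero_of : ∀ {d : ι →₀ ℕ}, Finsupp.weight w d = 0 → d = 0 := fun {d} hd => by
    ext j
    have h := hle_of d j
    rw [hd, ← zero_mul (w j)] at h
    rw [Finsupp.coe_zero, Pi.zero_apply]
    exact Nat.cast_nonpos.mp (le_of_mul_le_mul_right h (hw j))
  have hle : (m i : ℚ) * w i ≤ Finsupp.weight w m := hle_of m i
  have hceq : c = 1 := by
    by_contra hne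
    have h2 : 2 ≤ c := by omega
    have hlt : (p : ℚ) * w i < (m i : ℚ) * w i := by
      refine mul_lt_mul_of_pos_right ?_ (hw i)
      have hp0 := hp.out.pos
      have : p < m i := by
        rw [hc]; exact lt_of_lt_of_le (by omega) (Nat.mul_le_mul_left p h2)
      exact_mod_cast this
    rw [hwt, ← hi] at hle
    exact absurd hle (not_le.mpr hlt)
  have hmip : m i = p := by rw [hc, hceq, mul_one]
  have hsplit := Finsupp.erase_add_single i m
  have hw0 : Finsupp.weight w (m.erase i) = 0 := by
    have h := congrArg (Finsupp.weight w) hsplit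
    rw [map_add, Finsupp.weight_single, hmip, nsmul_eq_mul, hwt, ← hi] at h
    linear_combination h
  rw [← hsplit, zero_of hw0, zero_add, hmip]

/-- **THEOREM B⁗ (i)–(ii) FROBENIUS SPLITTING** (THEOREM-LT §12: "`P ∈ k[f_i^p (i ≤ r), f″, V]`, and since `f_i^p` already has value `1`:
`P = Σ_{i≤r} a_i f_i^p + P₀(f″, V)`"; (ii) is the case `S = {f₁}`: "`∂_{f₁}g = 0 ⇒ g = a f₁^p + g₀`"; ours as a formal statement, the normal form
DERIVED rather than assumed as in `card_le_one_of_forall_mem_vars`): in characteristic `p`, if `P` is weighted homogeneous of weight `μ`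
(positive rational weights), every slot `i ∈ S` has `p·w_i = μ` and `∂_i P = 0` on `S`, then `P = Σ_{i∈S} a_i X_i^p + P₀` with
`a_i = coeff_{p e_i} P` and `P₀ := P − Σ_{i∈S} a_i X_i^p` free of the `S`-variables. [cite: Lang2002, Ch. V §6] -/
theorem eq_sum_frobenius_add [DecidableEq ι] {w : ι → ℚ} (hw : ∀ j, 0 < w j) {μ : ℚ} {P : MvPolynomial ι L}
    (hP : IsWeightedHomogeneous w P μ) (S : Finset ι) (hS : ∀ i ∈ S, (p : ℚ) * w i = μ) (hD : ∀ i ∈ S, pderiv i P = 0) :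
    (∀ i ∈ S, i ∉ (P - ∑ j ∈ S, C (P.coeff (Finsupp.single j p)) * X j ^ p).vars) ∧
      P = ∑ j ∈ S, C (P.coeff (Finsupp.single j p)) * X j ^ p + (P - ∑ j ∈ S, C (P.coeff (Finsupp.single j p)) * X j ^ p) := by
  refine ⟨fun i hi => ?_, (add_sub_cancel _ _).symm⟩
  have key : ∀ m : ι →₀ ℕ, m i ≠ 0 → m ≠ Finsupp.single i p → P.coeff m = 0 := fun m hmi hne => by
    by_contra hc
    exact hne (eq_single_of_pderiv_eq_zero p hw hP (hS i hi) (hD i hi) (mem_support_iff.mpr hc) hmi)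
  rw [mem_vars_iff_mem_support]
  rintro ⟨m, hm, him⟩
  have hmi : m i ≠ 0 := Finsupp.mem_support_iff.mp him
  rw [mem_support_iff, coeff_sub, coeff_sum] at hm
  apply hm
  simp_rw [X_pow_eq_monomial, C_mul_monomial, mul_one, coeff_monomial]
  by_cases hme : m = Finsupp.single i p
  · subst hme
    rw [Finset.sum_eq_single_of_mem i hi (fun j _ hji => if_neg fun h =>
      hji (Finsupp.single_left_injective hp.out.ne_zero h)), if_pos rfl, sub_self]
  · have hc0 : P.coeff m = 0 := key m hmi hme
    rw [hc0, Finset.sum_eq_zero (fun j _ => ?_), sub_zero]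
    split_ifs with h
    · rw [h, hc0]
    · rfl

/-- **THEOREM B⁗ (i) RANK ONE, Frobenius splitting derived** (ours as a formal statement): in characteristic `p`, if `P` is weighted
homogeneous of weight `μ` (positive weights), `p·w_i = μ` and `∂_i P = 0` for `i ∈ S`, the diagonal coefficients `coeff_{p e_i} P` have
`p`-th roots `b_i` (automatic over a perfect field; data here), and SOME variable occurs in `P∘A` for every invertible `A` (the formal (P)),
then `|S| ≤ 1`. [cite: Lang2002, Ch. V §6] -/
theorem card_le_one_of_pderiv_eq_zero [Fintype ι] [DecidableEq ι] {w : ι → ℚ} (hw : ∀ j, 0 < w j) {μ : ℚ}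
    {P : MvPolynomial ι L} (hP : IsWeightedHomogeneous w P μ) (S : Finset ι) (hS : ∀ i ∈ S, (p : ℚ) * w i = μ)
    (hD : ∀ i ∈ S, pderiv i P = 0) (b : ι → L) (hb : ∀ i ∈ S, b i ^ p = P.coeff (Finsupp.single i p)) (i₀ : ι)
    (hPin : ∀ A A' : Matrix ι ι L, A * A' = 1 → A' * A = 1 → i₀ ∈ (linSubst (fun j k => A j k) P).vars) :
    S.card ≤ 1 := by
  obtain ⟨hP₀, hsplit⟩ := eq_sum_frobenius_add p hw hP S hS hD
  refine card_le_one_of_forall_mem_vars p S (fun i => P.coeff (Finsupp.single i p)) b hb _ hP₀ i₀ fun A A' hA hA' => ?_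
  have h := hPin A A' hA hA'
  rw [hsplit] at h
  exact h

omit hp in
/-- **THEOREM B⁗ (i), the first step** (THEOREM-LT §12: "`D P = Σ_i ℓ_i(W) ∂_{f_i} P = 0`; `P` is `W`-free and the `ℓ_i` are independent,
hence `∂_{f_i} P = 0`"; ours as a formal statement, in the natural generality): if `Σ_a ℓ_a · Q_a = 0` with linear forms
`ℓ_a = Σ_{n∈T} c_{an} X_n` in the `T`-variables whose coefficient matrix has a right inverse `d` (= the `ℓ_a` are linearly independent)
and every `Q_a` is free of the `T`-variables, then every `Q_a = 0` (differentiate along `X_n`, `n ∈ T`, and invert). [cite: Lang2002, Ch. IV §1] -/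
theorem eq_zero_of_sum_linearForm_mul [DecidableEq ι] {r : Type*} [Fintype r] [DecidableEq r] (T : Finset ι)
    (c : r → ι → L) (d : ι → r → L) (hcd : ∀ a b, ∑ n ∈ T, c a n * d n b = if a = b then (1 : L) else 0)
    (Q : r → MvPolynomial ι L) (hQ : ∀ a, ∀ n ∈ T, n ∉ (Q a).vars)
    (h : ∑ a, (∑ n ∈ T, C (c a n) * X n) * Q a = 0) : ∀ a, Q a = 0 := by
  have hder : ∀ n ∈ T, ∑ a, C (c a n) * Q a = 0 := by
    intro n hn
    have h1 := congrArg (pderiv n) h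
    rw [map_zero, map_sum] at h1
    rw [← h1]
    refine Finset.sum_congr rfl fun a _ => ?_
    rw [pderiv_mul, pderiv_eq_zero_of_notMem_vars (hQ a n hn), mul_zero, add_zero, map_sum,
      Finset.sum_eq_single_of_mem n hn (fun n' _ hn' => by rw [pderiv_C_mul, pderiv_X_of_ne hn', mul_zero]),
      pderiv_C_mul, pderiv_X_self, mul_one]
  intro b
  have H : ∑ n ∈ T, C (d n b) * ∑ a, C (c a n) * Q a = Q b := by
    calc ∑ n ∈ T, C (d n b) * ∑ a, C (c a n) * Q a
        = ∑ a, C (∑ n ∈ T, c a n * d n b) * Q a := by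
          simp_rw [Finset.mul_sum, map_sum, Finset.sum_mul]
          rw [Finset.sum_comm]
          refine Finset.sum_congr rfl fun a _ => Finset.sum_congr rfl fun n _ => ?_
          rw [map_mul]; ring
      _ = Q b := by
          rw [Finset.sum_eq_single_of_mem b (Finset.mem_univ b) (fun a _ hab => by rw [hcd, if_neg hab, C_0, zero_mul]),
            hcd, if_pos rfl, C_1, one_mul]
  rw [← H]
  exact Finset.sum_eq_zero fun n hn => by rw [hder n hn, mul_zero]

/-- **THEOREM B⁗ (i) RANK ONE from `D P = 0`** (ours as a formal statement; the whole of §12 (i) for the pin part `P`): `D = Σ_a ℓ_a(W)·∂_{f_a}`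
with independent linear forms `ℓ_a` in the `W`-variables `T` (right inverse `d`), distinct moved slots `f_a ∉ T` of weight `μ/p`, `P` weighted
homogeneous of weight `μ` and `W`-free with `D P = 0`, `p`-th roots of the diagonal coefficients given, and the formal (P) — then at most ONE
slot is moved (`r ≤ 1`). [cite: Lang2002, Ch. V §6] -/
theorem card_le_one_of_D_eq_zero [Fintype ι] [DecidableEq ι] {r : Type*} [Fintype r] [DecidableEq r] {w : ι → ℚ}
    (hw : ∀ j, 0 < w j) {μ : ℚ} {P : MvPolynomial ι L} (hP : IsWeightedHomogeneous w P μ) (T : Finset ι)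
    (hPT : ∀ n ∈ T, n ∉ P.vars) (f : r → ι) (hf : Function.Injective f) (hfw : ∀ a, (p : ℚ) * w (f a) = μ)
    (c : r → ι → L) (d : ι → r → L) (hcd : ∀ a b, ∑ n ∈ T, c a n * d n b = if a = b then (1 : L) else 0)
    (hDP : ∑ a, (∑ n ∈ T, C (c a n) * X n) * pderiv (f a) P = 0)
    (b : r → L) (hb : ∀ a, b a ^ p = P.coeff (Finsupp.single (f a) p)) (i₀ : ι)
    (hPin : ∀ A A' : Matrix ι ι L, A * A' = 1 → A' * A = 1 → i₀ ∈ (linSubst (fun j k => A j k) P).vars) :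
    Fintype.card r ≤ 1 := by
  have hQ : ∀ a, pderiv (f a) P = 0 :=
    eq_zero_of_sum_linearForm_mul T c d hcd (fun a => pderiv (f a) P) (fun a n hn => notMem_vars_pderiv (f a) (hPT n hn)) hDP
  have hcard : (Finset.univ.image f).card = Fintype.card r := by
    rw [Finset.card_image_of_injective _ hf, Finset.card_univ]
  rw [← hcard]
  refine card_le_one_of_pderiv_eq_zero p hw hP (Finset.univ.image f) (fun i hi => ?_) (fun i hi => ?_)
    (Function.extend f b 0) (fun i hi => ?_) i₀ hPin
  · obtain ⟨a, -, rfl⟩ := Finset.mem_image.mp hi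
    exact hfw a
  · obtain ⟨a, -, rfl⟩ := Finset.mem_image.mp hi
    exact hQ a
  · obtain ⟨a, -, rfl⟩ := Finset.mem_image.mp hi
    rw [hf.extend_apply]
    exact hb a


/-- **THEOREM B⁗ (i) over a field with surjective Frobenius** (derived here; v9): when every element of `L` is a `p`-th power
(perfect fields: `𝔽_p`, `𝔽_q`, `k̄` — `exists_pow_eq_zmod` below gives `𝔽_p`), the root data `b` of `card_le_one_of_D_eq_zero` are
automatic: `DP = 0` + (P) for the class of `f_{i₀}` ⇒ `r ≤ 1` with NO normal-form or root hypothesis left.  INSTRUMENT for engine 1's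
`W(f)` toy model, NOT a resolution theorem. [cite: AbramovichTemkinWlodarczyk2024, §5.1; Lang2002, Ch. V §6] -/
theorem card_le_one_of_D_eq_zero_of_surjective_frobenius [Fintype ι] [DecidableEq ι] {r : Type*} [Fintype r] [DecidableEq r]
    (hperf : ∀ x : L, ∃ y : L, y ^ p = x) {w : ι → ℚ}
    (hw : ∀ j, 0 < w j) {μ : ℚ} {P : MvPolynomial ι L} (hP : IsWeightedHomogeneous w P μ) (T : Finset ι)
    (hPT : ∀ n ∈ T, n ∉ P.vars) (f : r → ι) (hf : Function.Injective f) (hfw : ∀ a, (p : ℚ) * w (f a) = μ)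
    (c : r → ι → L) (d : ι → r → L) (hcd : ∀ a b, ∑ n ∈ T, c a n * d n b = if a = b then (1 : L) else 0)
    (hDP : ∑ a, (∑ n ∈ T, C (c a n) * X n) * pderiv (f a) P = 0) (i₀ : ι)
    (hPin : ∀ A A' : Matrix ι ι L, A * A' = 1 → A' * A = 1 → i₀ ∈ (linSubst (fun j k => A j k) P).vars) :
    Fintype.card r ≤ 1 :=
  card_le_one_of_D_eq_zero p hw hP T hPT f hf hfw c d hcd hDP (fun a => (hperf (P.coeff (Finsupp.single (f a) p))).choose)
    (fun a => (hperf (P.coeff (Finsupp.single (f a) p))).choose_spec) i₀ hPin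

/-- The hypothesis of `card_le_one_of_D_eq_zero_of_surjective_frobenius` for the prime field `𝔽_p = ZMod p` (plumbing:
`ZMod.pow_card`). [cite: Lang2002, Ch. V §5] -/
theorem exists_pow_eq_zmod (x : ZMod p) : ∃ y : ZMod p, y ^ p = x :=
  ⟨x, ZMod.pow_card x⟩

end FrobeniusSplitting

end InvariantDirection

end Literature.AlgebraicGeometry.Resolution.WeightedBlowup
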